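import Summits.BirchSwinnertonDyer.Rank1Residual.X2.TorsionComparison
import HarnessLib

/-!
# The `n`-torsion comparison, part 2: Greenberg-type local conditions correspond exactly under
# `α : H¹(G, M[n]) → H¹(G, M)`; Selmer-type subgroups; the count `#S' = #S[n] · #(M^G/n)`

HONEST FRAMING (cell `b2b-bsdres`, run/shared/lean/b2b/bsd-rank1-residual/, verbatim in every
file): the goal of the cell is to DELETE the COMBINATION-SHAPED residual classes of the
Birch–Swinnerton-Dyer formula for ALL analytic-rank `≤ 1` elliptic curves over `ℚ` — "full BSD
formula for every rank `≤ 1` curve in class `C`" assembled STRICTLY from published theorems — so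
that the rank-`≤ 1` remainder becomes exactly the CONSTRUCTION-SHAPED classes, which are TYPED
(missing-input `Prop`s), NOT attempted. This is not "finishing BSD". Sub-cell
`b2b-bsdres-eisenstein-p2` (CLASS-OWNERS row "X2"), gen 8: research route; NO CLAIM BEYOND STATED
CLASSES; nothing here changes a label. GENERIC continuous group cohomology (no number theory): every
declaration is a definition with a body or a proved theorem; no named fact. Continuation of
`X2/TorsionComparison.lean` (referee R98.2 option (β): kernel proof of the `E(ℚ)[p]`-corrected
Greenberg–Vatsal comparison, flag `GV-Prop28-H0-remark`).

CONTENT (notation of part 1: `α = torsionToH1 G M n`, `δ = delta`, `M^G = invariants G M`).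
* §3 LOCAL CONDITIONS OF GREENBERG TYPE: a compatible pair `(φ : I →ₜ* G, ψ : M →+ Q)` into a
  discrete `I`-module `Q` ON WHICH `I` ACTS TRIVIALLY, and for `M[n]` a pair `(φ, ψ' : M[n] →+ Q')`
  with an injective `I`-map `κ : Q' → Q`, `κ ∘ ψ' = ψ ∘ ι`. Then **`resH1Hom φ ψ' _ c = 0 ↔
  resH1Hom φ ψ _ (α c) = 0`** (`localCondition_iff`) — Greenberg–Vatsal's "the map
  `H¹(I_η, A[π]) → H¹(I_η, A)` is injective because `H⁰(I_η, A) = A` is divisible … the map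
  `H¹(I_p, D[π]) → H¹(I_p, D)` is injective because `H⁰(I_p, D) = D` is divisible" (proof of
  Prop. (2.8), p. 25) in the sharper form "`H¹(I, Q') → H¹(I, Q)` is injective because `I` acts
  trivially and `Q' ↪ Q`" (`resH1Hom_id_injective_of_trivial`; `H¹ = Hom_cont` for trivial actions,
  file `H1TrivialAction`).
* §4 SELMER-TYPE CONSEQUENCE: for subgroups `S ≤ H¹(G, M)`, `S' ≤ H¹(G, M[n])` whose memberships
  correspond under `α` (`∀ c, c ∈ S' ↔ α c ∈ S` — which §3 supplies condition by condition):
  `ker α ≤ S'` (`ker_le_of_iff`), **`α(S') = S ⊓ H¹(G, M)[n]`** (`map_eq_inf_torsionBy`), the exact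
  sequence `0 → ker α → S' → S ⊓ H¹[n] → 0` (`quotientKerEquiv`), the count
  **`#S' = #(S ⊓ H¹[n]) · #(M^G/n·M^G)`** (`natCard_eq`; `= … · #M^G[n]` for finite `M^G`,
  `natCard_eq_of_finite_invariants`), and Greenberg–Vatsal's printed case: `α : S' ≃ S ⊓ H¹[n]`
  bijective when `M^G` is finite without `n`-torsion, e.g. `H⁰(ℚ_∞, A) = 0`
  (`alphaOn_bijective_of_noTorsionInvariants`).

References: R. Greenberg, V. Vatsal, Invent. Math. 142 (2000) = arXiv:math/9906215, §2 Prop. (2.8)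
(proof, p. 25), p. 26; J.-P. Serre, *Galois Cohomology*, I.§2.3–2.4, I.§5.1; Neukirch–Schmidt–
Wingberg, (1.2), I.§5.
-/

noncomputable section

open scoped Classical AddSubgroup

universe u

namespace Summit.BirchSwinnertonDyer.Rank1Residual.X2.TorsionComparison

open Literature.NumberTheory.EllipticCurves Literature.NumberTheory.GaloisRepresentations

variable {G : Type u} [Group G] [TopologicalSpace G] [IsTopologicalGroup G]
variable {M : Type u} [AddCommGroup M] [DistribMulAction G M] [TopologicalSpace M]
  [DiscreteTopology M]

/-! ## §2b. Counting `ker α` -/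

section Count

/-- For a FINITE abelian group `B`, `#(B / nB) = #B[n]` (both are `#B / #nB`). [folklore] -/
theorem natCard_quotient_range_nsmul_eq (B : Type*) [AddCommGroup B] [Finite B] (n : ℕ) :
    Nat.card (B ⧸ (nsmulAddMonoidHom (α := B) n).range) = Nat.card (B[(n : ℤ)]) := by
  set m : B →+ B := nsmulAddMonoidHom n with hm
  have hker : m.ker = B[(n : ℤ)] := by
    ext x
    rw [AddMonoidHom.mem_ker, hm, nsmulAddMonoidHom_apply, AddSubgroup.torsionBy.nsmul_iff]
  have h1 := AddSubgroup.card_eq_card_quotient_mul_card_addSubgroup m.ker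
  have h2 := AddSubgroup.card_eq_card_quotient_mul_card_addSubgroup m.range
  rw [Nat.card_congr (QuotientAddGroup.quotientKerEquivRange m).toEquiv, hker] at h1
  rw [mul_comm] at h2
  have hpos : 0 < Nat.card m.range := Nat.card_pos
  exact Nat.eq_of_mul_eq_mul_left hpos (h2.symm.trans h1)

/-- **`#ker α = #M^G[n]` when `M^G` is finite** (e.g. `M = E[p^∞]`, `M^{G_{K_∞}} = E(K_∞)[p^∞]`
finite: then `#(M^G/p) = #M^G[p] = #E(K_∞)[p]`).
[cite: GreenbergVatsal2000, §2 Prop. (2.8) (proof, p. 25)] -/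
theorem natCard_ker_torsionToH1 (hM : ∀ m : M, Continuous fun g : G ↦ g • m) {n : ℕ}
    (hdiv : ∀ m : M, ∃ m' : M, n • m' = m) [Finite (invariants G M)] :
    Nat.card (torsionToH1 G M n).ker = Nat.card ((invariants G M)[(n : ℤ)]) := by
  rw [← Nat.card_congr (kerEquiv hM hdiv).toEquiv]
  exact natCard_quotient_range_nsmul_eq (invariants G M) n

end Count

/-! ## §3. Local conditions of Greenberg type correspond exactly under `α` -/

section Local

variable {I : Type u} [Group I] [TopologicalSpace I] [IsTopologicalGroup I]
variable {Q : Type u} [AddCommGroup Q] [DistribMulAction I Q] [TopologicalSpace Q]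
  [DiscreteTopology Q]
variable {Q' : Type u} [AddCommGroup Q'] [DistribMulAction I Q'] [TopologicalSpace Q']
  [DiscreteTopology Q']

/-- **`H¹(I, Q') → H¹(I, Q)` is injective for an injective `I`-map `κ : Q' → Q` when `I` acts
trivially on `Q`** (then also on `Q'`; `H¹ = Hom_cont` on both sides and `f ↦ κ ∘ f` is injective).
This is the mechanism of GV's "the map `H¹(I_p, D[π]) → H¹(I_p, D)` is injective because
`H⁰(I_p, D) = D`". [cite: GreenbergVatsal2000, §2 Prop. (2.8) (proof, p. 25)] -/
theorem resH1Hom_id_injective_of_trivial (htriv : ∀ (x : I) (q : Q), x • q = q) (κ : Q' →+ Q)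
    (hκ : ∀ (x : I) (q' : Q'), κ (ContinuousMonoidHom.id I x • q') = x • κ q')
    (hinj : Function.Injective κ) :
    Function.Injective (resH1Hom (ContinuousMonoidHom.id I) κ hκ) := by
  have htriv' : ∀ (x : I) (q' : Q'), x • q' = q' := fun x q' ↦ hinj (by
    have := hκ x q'
    rw [htriv] at this
    exact this)
  rw [injective_iff_map_eq_zero]
  intro c hc
  obtain ⟨f, rfl⟩ := classHom_surjective (G := I) (M := Q') c
  rw [classHom_apply, resH1Hom_id_oneCocycleClass,
    oneCocycleClass_eq_zero_iff_of_trivial htriv] at hc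
  rw [classHom_apply, oneCocycleClass_eq_zero_iff_of_trivial htriv']
  apply Subtype.ext; ext x
  apply hinj
  have h1 : κ (f.1 x) = 0 := by
    have h2 := congrArg (fun φ : contOneCocycles (discreteTopRep I Q) ↦ φ.1 x) hc
    change κ (f.1 x) = (0 : contOneCocycles (discreteTopRep I Q)).1 x at h2
    rw [h2]; rfl
  rw [h1]
  exact (map_zero κ).symm

/-- **Local conditions of Greenberg type correspond exactly under `α`.** Let `(φ : I →ₜ* G,
ψ : M →+ Q)` be a compatible pair into a discrete `I`-module `Q` on which `I` acts TRIVIALLY, and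
`(φ, ψ' : M[n] →+ Q')` a compatible pair with an injective `I`-map `κ : Q' → Q` such that
`κ ∘ ψ' = ψ ∘ ι`. Then for every `c ∈ H¹(G, M[n])`:
`res_{(φ,ψ')} c = 0 ↔ res_{(φ,ψ)} (α c) = 0`. Instances: `I` an inertia group acting trivially on
`Q = M` (unramified place, `ψ = id`, `Q' = M[n]`), or on `Q = D = M/M⁺` (Greenberg's condition at
`p`, `Q' = M[n]/(M[n] ∩ M⁺) ↪ D`). [cite: GreenbergVatsal2000, §2 Prop. (2.8) (proof, p. 25)] -/
theorem localCondition_iff (htriv : ∀ (x : I) (q : Q), x • q = q) {n : ℕ} (φ : I →ₜ* G)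
    (ψ : M →+ Q) (h : ∀ (x : I) (m : M), ψ (φ x • m) = x • ψ m)
    (ψ' : M[(n : ℤ)] →+ Q') (h' : ∀ (x : I) (m : M[(n : ℤ)]), ψ' (φ x • m) = x • ψ' m)
    (κ : Q' →+ Q) (hκ : ∀ (x : I) (q' : Q'), κ (ContinuousMonoidHom.id I x • q') = x • κ q')
    (hinj : Function.Injective κ) (hsq : ∀ m : M[(n : ℤ)], κ (ψ' m) = ψ (m : M))
    (c : discreteH1 G (M[(n : ℤ)])) :
    resH1Hom φ ψ' h' c = 0 ↔ resH1Hom φ ψ h (torsionToH1 G M n c) = 0 := by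
  -- both `κ_* ∘ res_{(φ,ψ')}` and `res_{(φ,ψ)} ∘ α` are `res` of the pair `(φ, ψ ∘ ι = κ ∘ ψ')`
  have hcomp : resH1Hom φ ψ h (torsionToH1 G M n c) =
      resH1Hom (ContinuousMonoidHom.id I) κ hκ (resH1Hom φ ψ' h' c) := by
    rw [torsionToH1, resH1Hom_resH1Hom, resH1Hom_resH1Hom]
    exact congrFun (congrArg DFunLike.coe
      (resH1Hom_congr (by ext; rfl) (by ext m; exact (hsq m).symm) _ _)) c
  rw [hcomp, map_eq_zero_iff _ (resH1Hom_id_injective_of_trivial htriv κ hκ hinj)]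

end Local

/-! ## §4. Selmer-type subgroups whose local conditions correspond under `α` -/

section Selmer

variable {n : ℕ} (S : AddSubgroup (discreteH1 G M)) (S' : AddSubgroup (discreteH1 G (M[(n : ℤ)])))

/-- If memberships correspond under `α` (`c ∈ S' ↔ α c ∈ S`), then `S' = α⁻¹(S)`. [folklore] -/
theorem eq_comap_of_iff (hSS' : ∀ c, c ∈ S' ↔ torsionToH1 G M n c ∈ S) :
    S' = S.comap (torsionToH1 G M n) :=
  AddSubgroup.ext fun c ↦ (hSS' c).trans AddSubgroup.mem_comap.symm

/-- **`ker α ≤ S'`**: the connecting classes `δ(M^G)` satisfy every local condition (because `0 ∈ S`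
does). Greenberg–Vatsal's Prop. (2.8) is the case `ker α = 0`.
[cite: GreenbergVatsal2000, §2 Prop. (2.8) (proof, p. 25)] -/
theorem ker_le_of_iff (hSS' : ∀ c, c ∈ S' ↔ torsionToH1 G M n c ∈ S) :
    (torsionToH1 G M n).ker ≤ S' := fun c hc ↦
  (hSS' c).2 (by rw [(AddMonoidHom.mem_ker).1 hc]; exact zero_mem S)

/-- **`α(S') = S ⊓ H¹(G, M)[n]`** for `n`-divisible `M` with continuous orbit maps.
[cite: GreenbergVatsal2000, §2 Prop. (2.8) (proof, p. 25)] -/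
theorem map_eq_inf_torsionBy (hM : ∀ m : M, Continuous fun g : G ↦ g • m)
    (hdiv : ∀ m : M, ∃ m' : M, n • m' = m)
    (hSS' : ∀ c, c ∈ S' ↔ torsionToH1 G M n c ∈ S) :
    S'.map (torsionToH1 G M n) = S ⊓ (discreteH1 G M)[(n : ℤ)] := by
  ext c
  rw [AddSubgroup.mem_map, AddSubgroup.mem_inf, ← range_torsionToH1_eq hM hdiv]
  constructor
  · rintro ⟨c', hc', rfl⟩
    exact ⟨(hSS' c').1 hc', ⟨c', rfl⟩⟩
  · rintro ⟨hc, ⟨c', rfl⟩⟩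
    exact ⟨c', (hSS' c').2 hc, rfl⟩

/-- `α` restricted to `S'`, with values in `S ⊓ H¹(G, M)[n]`. [folklore] -/
def alphaOn (hSS' : ∀ c, c ∈ S' ↔ torsionToH1 G M n c ∈ S) :
    S' →+ (S ⊓ (discreteH1 G M)[(n : ℤ)] : AddSubgroup (discreteH1 G M)) :=
  ((torsionToH1 G M n).comp S'.subtype).codRestrict _ fun c ↦
    AddSubgroup.mem_inf.2 ⟨(hSS' c.1).1 c.2, torsionToH1_mem_torsionBy n c.1⟩

/-- `alphaOn` is `α` on underlying classes. [folklore] -/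
@[simp]
theorem coe_alphaOn_apply (hSS' : ∀ c, c ∈ S' ↔ torsionToH1 G M n c ∈ S) (c : S') :
    ((alphaOn S S' hSS' c : (S ⊓ (discreteH1 G M)[(n : ℤ)] : AddSubgroup (discreteH1 G M))) :
      discreteH1 G M) = torsionToH1 G M n c :=
  rfl

/-- **`S' → S[n]` is surjective** (for `n`-divisible `M`).
[cite: GreenbergVatsal2000, §2 Prop. (2.8) (proof, p. 25)] -/
theorem alphaOn_surjective (hM : ∀ m : M, Continuous fun g : G ↦ g • m)
    (hdiv : ∀ m : M, ∃ m' : M, n • m' = m)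
    (hSS' : ∀ c, c ∈ S' ↔ torsionToH1 G M n c ∈ S) :
    Function.Surjective (alphaOn S S' hSS') := by
  rintro ⟨c, hc⟩
  have hc' : c ∈ S'.map (torsionToH1 G M n) := by rwa [map_eq_inf_torsionBy S S' hM hdiv hSS']
  obtain ⟨c', hc'S, rfl⟩ := AddSubgroup.mem_map.1 hc'
  exact ⟨⟨c', hc'S⟩, Subtype.ext rfl⟩

/-- **The kernel of `S' → S[n]` is `ker α`** (which lies in `S'`).
[cite: GreenbergVatsal2000, §2 Prop. (2.8) (proof, p. 25)] -/
theorem ker_alphaOn_eq (hSS' : ∀ c, c ∈ S' ↔ torsionToH1 G M n c ∈ S) :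
    (alphaOn S S' hSS').ker = ((torsionToH1 G M n).ker).addSubgroupOf S' := by
  ext c
  rw [AddMonoidHom.mem_ker, AddSubgroup.mem_addSubgroupOf, AddMonoidHom.mem_ker,
    ← coe_alphaOn_apply S S' hSS' c]
  exact ⟨fun h ↦ by rw [h]; rfl, fun h ↦ Subtype.ext h⟩

/-- **The exact sequence `0 → ker α → S' → S ⊓ H¹(G,M)[n] → 0`, as an isomorphism
`S' / ker α ≃ S ⊓ H¹(G, M)[n]`** — Greenberg–Vatsal's `S^{Σ₀}_A(ℚ_∞)[π] ≅ S^{Σ₀}_{A[π]}(ℚ_∞)`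
corrected by the kernel `ker α ≅ H⁰(ℚ_∞, A)/π` when `H⁰ ≠ 0`.
[cite: GreenbergVatsal2000, §2 Prop. (2.8) (proof, p. 25)] -/
def quotientKerEquiv (hM : ∀ m : M, Continuous fun g : G ↦ g • m)
    (hdiv : ∀ m : M, ∃ m' : M, n • m' = m)
    (hSS' : ∀ c, c ∈ S' ↔ torsionToH1 G M n c ∈ S) :
    S' ⧸ ((torsionToH1 G M n).ker).addSubgroupOf S' ≃+
      (S ⊓ (discreteH1 G M)[(n : ℤ)] : AddSubgroup (discreteH1 G M)) :=
  (QuotientAddGroup.quotientAddEquivOfEq (ker_alphaOn_eq S S' hSS')).symm.trans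
    (QuotientAddGroup.quotientKerEquivOfSurjective _ (alphaOn_surjective S S' hM hdiv hSS'))

/-- **The count `#S' = #(S ⊓ H¹(G, M)[n]) · #(M^G / n·M^G)`** (as `Nat.card`s; both sides are `0`
when infinite). With `S = S^{Σ₀}_A(K_∞)`, `S' = S^{Σ₀}_{A[p]}(K_∞)`, `n = p`: GV's
`dim S^{Σ₀}_{A[p]} = dim S^{Σ₀}_A[p]` acquires the correction term `dim A(K_∞)/p`.
[cite: GreenbergVatsal2000, §2 Prop. (2.8) (proof, p. 25)] -/
theorem natCard_eq (hM : ∀ m : M, Continuous fun g : G ↦ g • m)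
    (hdiv : ∀ m : M, ∃ m' : M, n • m' = m)
    (hSS' : ∀ c, c ∈ S' ↔ torsionToH1 G M n c ∈ S) :
    Nat.card S' = Nat.card (S ⊓ (discreteH1 G M)[(n : ℤ)] : AddSubgroup (discreteH1 G M)) *
      Nat.card (invariants G M ⧸ nsmulInvariants G M n) := by
  rw [AddSubgroup.card_eq_card_quotient_mul_card_addSubgroup
      (((torsionToH1 G M n).ker).addSubgroupOf S'),
    Nat.card_congr (quotientKerEquiv S S' hM hdiv hSS').toEquiv]
  congr 1
  rw [Nat.card_congr (AddSubgroup.addSubgroupOfEquivOfLe (ker_le_of_iff S S' hSS')).toEquiv,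
    ← Nat.card_congr (kerEquiv (G := G) (M := M) hM hdiv).toEquiv]

/-- The count with `#(M^G/n) = #M^G[n]` for finite invariants: **`#S' = #(S ⊓ H¹[n]) · #M^G[n]`**.
[cite: GreenbergVatsal2000, §2 Prop. (2.8) (proof, p. 25)] -/
theorem natCard_eq_of_finite_invariants (hM : ∀ m : M, Continuous fun g : G ↦ g • m)
    (hdiv : ∀ m : M, ∃ m' : M, n • m' = m)
    (hSS' : ∀ c, c ∈ S' ↔ torsionToH1 G M n c ∈ S) [Finite (invariants G M)] :
    Nat.card S' = Nat.card (S ⊓ (discreteH1 G M)[(n : ℤ)] : AddSubgroup (discreteH1 G M)) *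
      Nat.card ((invariants G M)[(n : ℤ)]) := by
  rw [natCard_eq S S' hM hdiv hSS']
  congr 1
  exact natCard_quotient_range_nsmul_eq (invariants G M) n

/-- `ker α = ⊥` when the invariants are FINITE without `n`-torsion (`#ker α = #M^G[n] = 1`); in
particular under Greenberg–Vatsal's printed hypothesis `H⁰ = 0`.
[cite: GreenbergVatsal2000, §2 Prop. (2.8)] -/
theorem ker_torsionToH1_eq_bot (hM : ∀ m : M, Continuous fun g : G ↦ g • m)
    (hdiv : ∀ m : M, ∃ m' : M, n • m' = m) [Finite (invariants G M)]
    (h0 : ∀ m ∈ invariants G M, n • m = 0 → m = 0) : (torsionToH1 G M n).ker = ⊥ := by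
  have h1 : Nat.card ((invariants G M)[(n : ℤ)]) = 1 := by
    rw [Nat.card_eq_one_iff_exists]
    refine ⟨0, fun x ↦ ?_⟩
    have hx : n • ((x : invariants G M) : M) = 0 := by
      rw [← AddSubgroupClass.coe_nsmul, ← AddSubgroupClass.coe_nsmul, AddSubgroup.torsionBy.nsmul x]
      rfl
    exact Subtype.ext (Subtype.ext (h0 _ x.1.2 hx))
  exact AddSubgroup.eq_bot_of_card_eq _ ((natCard_ker_torsionToH1 hM hdiv).trans h1)

/-- **Greenberg–Vatsal's Prop. (2.8) as printed** (finite invariants without `n`-torsion, e.g.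
`H⁰(ℚ_∞, A) = 0`): `α : S' → S ⊓ H¹(G, M)[n]` is a BIJECTION.
[cite: GreenbergVatsal2000, §2 Prop. (2.8)] -/
theorem alphaOn_bijective_of_noTorsionInvariants (hM : ∀ m : M, Continuous fun g : G ↦ g • m)
    (hdiv : ∀ m : M, ∃ m' : M, n • m' = m)
    (hSS' : ∀ c, c ∈ S' ↔ torsionToH1 G M n c ∈ S) [Finite (invariants G M)]
    (h0 : ∀ m ∈ invariants G M, n • m = 0 → m = 0) :
    Function.Bijective (alphaOn S S' hSS') := by
  refine ⟨?_, alphaOn_surjective S S' hM hdiv hSS'⟩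
  rw [injective_iff_map_eq_zero]
  intro c hc
  have hc' : c ∈ (alphaOn S S' hSS').ker := (AddMonoidHom.mem_ker).2 hc
  rw [ker_alphaOn_eq, ker_torsionToH1_eq_bot hM hdiv h0, AddSubgroup.mem_addSubgroupOf,
    AddSubgroup.mem_bot] at hc'
  exact Subtype.ext hc'

end Selmer

end Summit.BirchSwinnertonDyer.Rank1Residual.X2.TorsionComparison

end
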